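import Summits.QuantumAdvantage.QuantumAdvantage.Theorems.CubicForrelationNearExactIsExactFourModSixPrep
import Summits.QuantumAdvantage.QuantumAdvantage.Theorems.CubicForrelationNearExactIsExactFourteenBoundary

/-!
# Crux `CubicForrelation.NearExactIsExact` (stmt-QuantumAdvantage-14043) — for EVERY `n ≡ 4 (mod 6)`, `n ≥ 16`, the boundary value
  `1 − 2^{−⌊n/3⌋−1}` of the uniform one-sided rate is NOT attained

Certificate seat `b2b-cforr-cert` (gen 6).  HONEST FRAMING: a theorem uniform in `n` over the residue class `n ≡ 4 (mod 6)` — infinitely many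
finite-slice verdicts at once; NOT summit progress (the constants tend to `1`; for `n = 16` the tree's `isolation_sixteen_closed` is sharper).

On `n = 6r+4` bits write `W_g = 2^{2r+2}u` (Ax); the parity `p = [u odd]` is AFFINE (tower) and the budget is `Σ(u − 2^r s)² = 2^{8r+5}(1−Φ)`,
which at `Φ ≥ 1 − 2^{−(2r+2)}` is `≤ 2^{6r+3} = N/2`.
* all `u` odd: every point costs `≥ 1`, total `≥ N` — impossible;
* `p` balanced (`fmb_split_false`): `L = {u odd}` is an affine HYPERPLANE (`2^{6r+3}` points, Ax count) carrying the whole budget, `τ = u − 2^r s = ±1`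
  on `L` and `0` off `L`; one transversal direction localises the general 4- and 5-flat sums (`4 ∣ Σ₄ u`, `8 ∣ Σ₅ u`; Ax for `f`) to `L`, giving
  (H3)/(H4), and the engine `fl1_flat_l1` yields `(Σ|τ̂|)² ≤ 2^{12r+10}` against the pairing `Σ (−1)^g τ̂ = 2^{8r+4}`;
* all `u` even: `fms_high_levels`.
Hence `fmb_isolation_ge` (`r ≥ 2`) and, at the literal type `Fin n`, `isolation_rate_closed_four_mod_six`, `theta_lt_rate_four_mod_six`.

References: as in the imported files.  Everything below is proved from Mathlib and the tree; axioms are the standard three.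
-/

set_option linter.dupNamespace false -- D-0017: single-problem summit ⇒ `QuantumAdvantage.QuantumAdvantage` by design

noncomputable section

namespace Summit.QuantumAdvantage.QuantumAdvantage.Theorems.CubicForrelation.NearExactIsExact

open Finset
open Literature.Computability.QuantumComplexity
open Literature.Computability.QuantumComplexity.BuzetChailloux (bxor zeroVec bxor_bxor_cancel_left bxor_zeroVec zeroVec_bxor bxor_comm
  bxor_self)
open Literature.Computability.QuantumComplexity.DerivativeWalsh (W)

/-- **The split configuration on `6r+4` bits at the boundary is empty (`r ≥ 2`).**  For cubic `f, g : 𝔽₂^{(3r+2)+(3r+2)} → 𝔽₂` with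
`W_g = 2^{2r+2}u`, some `u` odd, some `u` even, and `Φ(f,g) ≥ 1 − (1/2)^{2r+2}`: contradiction.  Uniform in `r`; NOT summit progress.
[this work] -/
theorem fmb_split_false (r : ℕ) (hr : 2 ≤ r) (f g : (Fin ((3 * r + 2) + (3 * r + 2)) → Bool) → Bool) (hf : IsDegLeFun 3 f)
    (hg : IsDegLeFun 3 g) (u : (Fin ((3 * r + 2) + (3 * r + 2)) → Bool) → ℤ)
    (hu : ∀ x, W (fun y => signOf (g y)) x = (2 : ℝ) ^ (2 * r + 2) * (u x : ℝ)) (hodd : ∃ x, Odd (u x)) (heven : ∃ x, ¬ Odd (u x))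
    (hΦ : 1 - (1 / 2 : ℝ) ^ (2 * r + 2) ≤ forrelation f g) : False := by
  classical
  obtain ⟨k, rfl⟩ : ∃ k, r = k + 2 := ⟨r - 2, by omega⟩
  obtain ⟨x₁, hx₁⟩ := hodd
  obtain ⟨x₂, hx₂⟩ := heven
  -- the parity is affine
  have hp : IsDegLeFun 1 (fun x => decide (Odd (u x))) :=
    stub_walshTower stub_axParity ((3 * (k + 2) + 2) + (3 * (k + 2) + 2)) (2 * (k + 2) + 2) 1 g u hg hu (by intro j hj hjn; omega)
  have hp' : IsDegLeFun (0 + 1) (fun x => decide (Odd (u x))) := hp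
  -- budget `Σ (u − 2^r s)² ≤ 2^{6r+3}`
  have hbud := fms_budget (k + 2) f g u hu
  have hpow : (2 : ℝ) ^ (8 * (k + 2) + 5) * (1 / 2) ^ (2 * (k + 2) + 2) = 2 ^ (6 * k + 15) := by
    rw [one_div_pow]; field_simp; ring
  have hB : (∑ x, (u x - 2 ^ (k + 2) * sZ (f x)) ^ 2 : ℤ) ≤ 2 ^ (6 * k + 15) := by
    have h1 : 1 - forrelation f g ≤ (1 / 2 : ℝ) ^ (2 * (k + 2) + 2) := by linarith
    have h' : ((∑ x, (u x - 2 ^ (k + 2) * sZ (f x)) ^ 2 : ℤ) : ℝ) ≤ (2 : ℝ) ^ (6 * k + 15) := by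
      rw [hbud, ← hpow]
      exact mul_le_mul_of_nonneg_left h1 (by positivity)
    exact_mod_cast h'
  -- odd points cost `≥ 1`
  set P := univ.filter (fun x : Fin ((3 * (k + 2) + 2) + (3 * (k + 2) + 2)) → Bool => Odd (u x)) with hPdef
  have hmemP : ∀ x, x ∈ P ↔ Odd (u x) := fun x => by simp [hPdef]
  have hfilt : (univ.filter fun x : Fin ((3 * (k + 2) + 2) + (3 * (k + 2) + 2)) → Bool => decide (Odd (u x)) = true) = P :=
    filter_congr fun x _ => by simp
  have hsumP : (∑ x, (if Odd (u x) then 1 else 0 : ℤ)) = #P := by rw [sum_boole]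
  have hnonneg : ∀ x, 0 ≤ (u x - 2 ^ (k + 2) * sZ (f x)) ^ 2 - (if Odd (u x) then 1 else 0 : ℤ) := by
    intro x
    by_cases h : Odd (u x)
    · rw [if_pos h]
      have hodd' : Odd (u x - 2 ^ (k + 2) * sZ (f x)) := by
        have h2 : Even ((2 : ℤ) ^ (k + 2) * sZ (f x)) := by rw [pow_succ]; exact ⟨2 ^ (k + 1) * sZ (f x), by ring⟩
        exact Int.odd_sub.2 (iff_of_true h h2)
      have h0 := Int.odd_iff.1 hodd'
      have : u x - 2 ^ (k + 2) * sZ (f x) ≤ -1 ∨ 1 ≤ u x - 2 ^ (k + 2) * sZ (f x) := by omega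
      have := tp_sq_ge (k := 1) (by norm_num) this
      linarith
    · rw [if_neg h]; have := sq_nonneg (u x - 2 ^ (k + 2) * sZ (f x)); linarith
  have hPle : (#P : ℤ) ≤ 2 ^ (6 * k + 15) := by
    rw [← hsumP]
    exact le_trans (sum_le_sum fun x _ => by have := hnonneg x; linarith) hB
  -- `#P = 2^{6r+3}`: Ax with `d = 1` on the full cube gives `2·#P = 2ⁿ − 2ⁿ·z`
  have hPcard : #P = 2 ^ (6 * k + 15) := by
    obtain ⟨z, hz⟩ := td_count_cube (le_refl 1) (fun x => decide (Odd (u x))) hp univ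
    rw [card_univ, Fintype.card_fin, show ((3 * (k + 2) + 2) + (3 * (k + 2) + 2) + 1 - 1) / 1 = 6 * k + 16 by omega] at hz
    have hset : ({x : Fin ((3 * (k + 2) + 2) + (3 * (k + 2) + 2)) → Bool | (∀ i, x i = true → i ∈ (univ : Finset _)) ∧
        decide (Odd (u x)) = true} : Finset _) = P := by
      ext x; simp [hPdef]
    rw [hset] at hz
    rw [show (2 : ℤ) ^ ((3 * (k + 2) + 2) + (3 * (k + 2) + 2)) = 2 ^ (6 * k + 16) by ring] at hz
    have hPpos : (0 : ℤ) < #P := by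
      have : 0 < #P := card_pos.2 ⟨x₁, (hmemP x₁).2 hx₁⟩
      exact_mod_cast this
    have hPlt : (#P : ℤ) < 2 ^ (6 * k + 16) := by
      have h1 : #P < #(univ : Finset (Fin ((3 * (k + 2) + 2) + (3 * (k + 2) + 2)) → Bool)) := by
        apply card_lt_card
        exact (ssubset_iff_of_subset (filter_subset _ _)).2 ⟨x₂, mem_univ _, by simp [hx₂]⟩
      rw [card_univ, Fintype.card_fun, Fintype.card_bool, Fintype.card_fin] at h1
      have h2 : ((#P : ℕ) : ℤ) < ((2 ^ ((3 * (k + 2) + 2) + (3 * (k + 2) + 2)) : ℕ) : ℤ) := by exact_mod_cast h1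
      push_cast at h2
      rw [show (2 : ℤ) ^ ((3 * (k + 2) + 2) + (3 * (k + 2) + 2)) = 2 ^ (6 * k + 16) by ring] at h2
      exact h2
    have hX : (0 : ℤ) < 2 ^ (6 * k + 16) := by positivity
    have hz0 : z = 0 := by
      rcases lt_trichotomy z 0 with h | h | h
      · have : (2 : ℤ) ^ (6 * k + 16) * z ≤ 2 ^ (6 * k + 16) * (-1) := mul_le_mul_of_nonneg_left (by omega) hX.le
        linarith
      · exact h
      · have : (2 : ℤ) ^ (6 * k + 16) * 1 ≤ 2 ^ (6 * k + 16) * z := mul_le_mul_of_nonneg_left (by omega) hX.le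
        linarith
    rw [hz0, mul_zero, sub_zero] at hz
    have : (#P : ℤ) = 2 ^ (6 * k + 15) := by
      have e : (2 : ℤ) ^ (6 * k + 16) = 2 * 2 ^ (6 * k + 15) := by ring
      linarith
    exact_mod_cast this
  -- everything is tight
  have hsum0 : ∑ x, ((u x - 2 ^ (k + 2) * sZ (f x)) ^ 2 - (if Odd (u x) then 1 else 0 : ℤ)) = 0 := by
    refine le_antisymm ?_ (sum_nonneg fun x _ => hnonneg x)
    rw [sum_sub_distrib, hsumP, hPcard]
    push_cast
    linarith
  have hzero' : ∀ x, (u x - 2 ^ (k + 2) * sZ (f x)) ^ 2 - (if Odd (u x) then 1 else 0 : ℤ) = 0 :=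
    fun x => (sum_eq_zero_iff_of_nonneg fun y _ => hnonneg y).1 hsum0 x (mem_univ x)
  have hoff : ∀ x, ¬ Odd (u x) → u x - 2 ^ (k + 2) * sZ (f x) = 0 := by
    intro x hx
    have h := hzero' x
    rw [if_neg hx, sub_zero] at h
    exact (pow_eq_zero_iff two_ne_zero).1 h
  have hon : ∀ x, Odd (u x) → u x - 2 ^ (k + 2) * sZ (f x) = 1 ∨ u x - 2 ^ (k + 2) * sZ (f x) = -1 := by
    intro x hx
    have h := hzero' x
    rw [if_pos hx] at h
    have h1 : (u x - 2 ^ (k + 2) * sZ (f x)) * (u x - 2 ^ (k + 2) * sZ (f x)) = 1 := by rw [← pow_two]; linarith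
    exact mul_self_eq_one_iff.1 h1
  have hTeq : (2 : ℝ) ^ (8 * (k + 2) + 5) * (1 - forrelation f g) = 2 ^ (6 * k + 15) := by
    have hT : (∑ x, (u x - 2 ^ (k + 2) * sZ (f x)) ^ 2 : ℤ) = 2 ^ (6 * k + 15) := by
      have e : ∀ x, (u x - 2 ^ (k + 2) * sZ (f x)) ^ 2 = ((u x - 2 ^ (k + 2) * sZ (f x)) ^ 2 - (if Odd (u x) then 1 else 0 : ℤ)) +
          (if Odd (u x) then 1 else 0 : ℤ) := fun x => by ring
      rw [sum_congr rfl fun x _ => e x, sum_add_distrib, hsum0, hsumP, hPcard]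
      push_cast; ring
    have h : ((∑ x, (u x - 2 ^ (k + 2) * sZ (f x)) ^ 2 : ℤ) : ℝ) = 2 ^ (6 * k + 15) := by exact_mod_cast hT
    rw [hbud] at h
    exact h
  -- `L = P` is a hyperplane
  have hmw := mw_flat_of_minweight 0 (fun x => decide (Odd (u x))) hp' (by rw [hfilt, hPcard]; ring)
  rw [hfilt] at hmw
  obtain ⟨h0, hadd, hcardV, hcoset⟩ := hmw
  set V₀ := univ.filter (fun a : Fin ((3 * (k + 2) + 2) + (3 * (k + 2) + 2)) → Bool => ∀ x,
    decide (Odd (u (bxor x a))) = decide (Odd (u x))) with hV₀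
  have hS : P = V₀.image (bxor x₁) := hcoset x₁ (by simpa using hx₁)
  rw [hPcard] at hcardV
  obtain ⟨t, -, ht⟩ := fl1_avoid univ V₀ [zeroVec] (by
    rw [List.length_singleton, hcardV, card_univ, Fintype.card_fun, Fintype.card_bool, Fintype.card_fin]
    have e : (2 : ℕ) ^ ((3 * (k + 2) + 2) + (3 * (k + 2) + 2)) = 2 * 2 ^ (6 * k + 15) := by ring
    rw [e]; have hX : 0 < 2 ^ (6 * k + 15) := Nat.two_pow_pos _; linarith)
  have htV : t ∉ V₀ := by simpa only [zeroVec_bxor] using ht zeroVec (by simp)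
  -- the sign pattern on `L` and the vanishing off `L`
  set e : (Fin ((3 * (k + 2) + 2) + (3 * (k + 2) + 2)) → Bool) → ℤ := fun x => u x - 2 ^ (k + 2) * sZ (f x) with hedef
  have he : ∀ x ∈ P, e x = 1 ∨ e x = -1 := fun x hx => hon x ((hmemP x).1 hx)
  have hF0 : ∀ y, y ∉ P → e y = 0 := fun y hy => hoff y (fun h => hy ((hmemP y).2 h))
  have hPV : ∀ x, x ∈ P → ∀ a ∈ V₀, bxor x a ∈ P := fun x hx a ha => fl1_coset_vadd hadd hS hx ha
  have hloc : ∀ {kk : ℕ} (x : Fin ((3 * (k + 2) + 2) + (3 * (k + 2) + 2)) → Bool)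
      (a : Fin kk → Fin ((3 * (k + 2) + 2) + (3 * (k + 2) + 2)) → Bool),
      (∀ ε : Fin kk → Bool, (fun j => x j ^^ decide (Odd #(univ.filter fun i => ε i && a i j))) ∈ P) →
      ∑ ε : Fin (kk + 1) → Bool, e (fun j => x j ^^ decide (Odd #(univ.filter fun i =>
          ε i && (Matrix.vecCons t a : Fin (kk + 1) → Fin ((3 * (k + 2) + 2) + (3 * (k + 2) + 2)) → Bool) i j))) =
      ∑ ε : Fin kk → Bool, e (fun j => x j ^^ decide (Odd #(univ.filter fun i => ε i && a i j))) := by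
    intro kk x a hin
    rw [fr_sum_peel e x t a, sum_eq_zero fun ε _ => hF0 _ (fl1_coset_out h0 hadd hS (hin ε) htV), add_zero]
  -- (H3) and (H4)
  have H3 : ∀ x ∈ P, ∀ a b c : Fin ((3 * (k + 2) + 2) + (3 * (k + 2) + 2)) → Bool, a ∈ V₀ → b ∈ V₀ → c ∈ V₀ →
      (4 : ℤ) ∣ ∑ ε : Fin 3 → Bool, e (fun j => x j ^^ decide (Odd #(univ.filter fun i =>
        ε i && (![a, b, c] : Fin 3 → Fin ((3 * (k + 2) + 2) + (3 * (k + 2) + 2)) → Bool) i j))) := by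
    intro x hx a b c ha hb hc
    have hin : ∀ ε : Fin 3 → Bool, (fun j => x j ^^ decide (Odd #(univ.filter fun i =>
        ε i && (![a, b, c] : Fin 3 → Fin ((3 * (k + 2) + 2) + (3 * (k + 2) + 2)) → Bool) i j))) ∈ P :=
      fun ε => fr_mem_flatPt3 V₀ h0 (· ∈ P) hPV hx ![a, b, c] (fun i => by fin_cases i <;> assumption) ε
    have h4 := fs_flat_sum_dvd (e := 2) g u hg hu x ![t, a, b, c] (by omega)
    obtain ⟨zf, hzf⟩ := sl_sum_sZ_flat f hf x ![t, a, b, c]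
    have hzf' : ∑ ε : Fin 4 → Bool, 2 ^ (k + 2) * sZ (f (fun j => x j ^^ decide (Odd #(univ.filter fun i =>
          ε i && (![t, a, b, c] : Fin 4 → Fin ((3 * (k + 2) + 2) + (3 * (k + 2) + 2)) → Bool) i j)))) = 4 * (2 ^ (k + 2) * zf) := by
      rw [← mul_sum, hzf]; norm_num; ring
    have h4n : (4 : ℤ) ∣ ∑ ε : Fin 4 → Bool, u (fun j => x j ^^ decide (Odd #(univ.filter fun i =>
          ε i && (![t, a, b, c] : Fin 4 → Fin ((3 * (k + 2) + 2) + (3 * (k + 2) + 2)) → Bool) i j))) := by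
      have e4 : (2 : ℤ) ^ 2 = 4 := by norm_num
      rw [e4] at h4; exact h4
    have h4' : (4 : ℤ) ∣ ∑ ε : Fin 4 → Bool, e (fun j => x j ^^ decide (Odd #(univ.filter fun i =>
          ε i && (![t, a, b, c] : Fin 4 → Fin ((3 * (k + 2) + 2) + (3 * (k + 2) + 2)) → Bool) i j))) := by
      simp only [e]
      rw [sum_sub_distrib, hzf']
      exact dvd_sub h4n (Dvd.intro _ rfl)
    rwa [hloc x ![a, b, c] hin] at h4'
  have H4 : ∀ x ∈ P, ∀ a₀ a₁ a₂ a₃ : Fin ((3 * (k + 2) + 2) + (3 * (k + 2) + 2)) → Bool, a₀ ∈ V₀ → a₁ ∈ V₀ → a₂ ∈ V₀ → a₃ ∈ V₀ →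
      (8 : ℤ) ∣ ∑ ε : Fin 4 → Bool, e (fun j => x j ^^ decide (Odd #(univ.filter fun i =>
        ε i && (![a₀, a₁, a₂, a₃] : Fin 4 → Fin ((3 * (k + 2) + 2) + (3 * (k + 2) + 2)) → Bool) i j))) := by
    intro x hx a₀ a₁ a₂ a₃ ha₀ ha₁ ha₂ ha₃
    have hin : ∀ ε : Fin 4 → Bool, (fun j => x j ^^ decide (Odd #(univ.filter fun i =>
        ε i && (![a₀, a₁, a₂, a₃] : Fin 4 → Fin ((3 * (k + 2) + 2) + (3 * (k + 2) + 2)) → Bool) i j))) ∈ P :=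
      fun ε => fr_mem_flatPt4 V₀ h0 (· ∈ P) hPV hx ![a₀, a₁, a₂, a₃] (fun i => by fin_cases i <;> assumption) ε
    have h8 := fs_flat_sum_dvd (e := 3) g u hg hu x ![t, a₀, a₁, a₂, a₃] (by omega)
    obtain ⟨zf, hzf⟩ := sl_sum_sZ_flat f hf x ![t, a₀, a₁, a₂, a₃]
    have hzf' : ∑ ε : Fin 5 → Bool, 2 ^ (k + 2) * sZ (f (fun j => x j ^^ decide (Odd #(univ.filter fun i =>
          ε i && (![t, a₀, a₁, a₂, a₃] : Fin 5 → Fin ((3 * (k + 2) + 2) + (3 * (k + 2) + 2)) → Bool) i j)))) = 8 * (2 ^ (k + 1) * zf) := by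
      rw [← mul_sum, hzf]; norm_num; ring
    have h8n : (8 : ℤ) ∣ ∑ ε : Fin 5 → Bool, u (fun j => x j ^^ decide (Odd #(univ.filter fun i =>
          ε i && (![t, a₀, a₁, a₂, a₃] : Fin 5 → Fin ((3 * (k + 2) + 2) + (3 * (k + 2) + 2)) → Bool) i j))) := by
      have e8 : (2 : ℤ) ^ 3 = 8 := by norm_num
      rw [e8] at h8; exact h8
    have h8' : (8 : ℤ) ∣ ∑ ε : Fin 5 → Bool, e (fun j => x j ^^ decide (Odd #(univ.filter fun i =>
          ε i && (![t, a₀, a₁, a₂, a₃] : Fin 5 → Fin ((3 * (k + 2) + 2) + (3 * (k + 2) + 2)) → Bool) i j))) := by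
      simp only [e]
      rw [sum_sub_distrib, hzf']
      exact dvd_sub h8n (Dvd.intro _ rfl)
    rwa [hloc x ![a₀, a₁, a₂, a₃] hin] at h8'
  -- the engine and the pairing
  have hE := fl1_flat_l1 V₀ P x₁ h0 hadd hS e he H3 H4
  set A : (Fin ((3 * (k + 2) + 2) + (3 * (k + 2) + 2)) → Bool) → ℝ := fun x => if x ∈ P then (e x : ℝ) else 0 with hA
  have hAτ : (fun x => (u x : ℝ) - (2 : ℝ) ^ (k + 2) * signOf (f x)) = A := by
    funext x
    have h2 : (u x : ℝ) - (2 : ℝ) ^ (k + 2) * signOf (f x) = ((e x : ℤ) : ℝ) := by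
      simp only [e]; push_cast; rw [tp_sZ_cast]
    rw [h2]
    by_cases hx : x ∈ P
    · simp only [A, if_pos hx]
    · simp only [A, if_neg hx]; rw [hF0 x hx]; norm_num
  have hpair := fms_pairing (k + 2) f g u hu
  rw [hAτ] at hpair
  have hP : ∑ y, signOf (g y) * W A y = (2 : ℝ) ^ (8 * k + 20) := by
    rw [hpair, show (2 : ℝ) ^ (10 * (k + 2) + 6) = 2 ^ (2 * k + 5) * 2 ^ (8 * (k + 2) + 5) by ring, mul_assoc, hTeq]
    ring
  have hge' : (2 : ℝ) ^ (8 * k + 20) ≤ ∑ y, |W A y| := by rw [← hP]; exact fl1_pairing_le_l1 g (W A)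
  have hsq : ((2 : ℝ) ^ (8 * k + 20)) ^ 2 ≤ (∑ y, |W A y|) ^ 2 := pow_le_pow_left₀ (by positivity) hge' 2
  have hEn : (∑ y, |W A y|) ^ 2 ≤ (2 : ℝ) ^ (12 * k + 34) := by
    refine hE.trans (le_of_eq ?_)
    rw [show ((3 * (k + 2) + 2) + (3 * (k + 2) + 2)) = 6 * k + 16 by ring]
    ring
  have hbig : (2 : ℝ) ^ (12 * k + 34) < ((2 : ℝ) ^ (8 * k + 20)) ^ 2 := by
    have e2 : ((2 : ℝ) ^ (8 * k + 20)) ^ 2 = 2 ^ (12 * k + 34) * 2 ^ (4 * k + 6) := by ring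
    rw [e2]
    have h1 : (1 : ℝ) < 2 ^ (4 * k + 6) := one_lt_pow₀ (by norm_num) (by omega)
    have h2 : (0 : ℝ) < 2 ^ (12 * k + 34) := by positivity
    exact lt_mul_of_one_lt_right h2 h1
  linarith

/-- **`Φ ≥ 1 − 2^{−(2r+2)} ⇒ Φ = 1` for cubic pairs on `(3r+2) + (3r+2)` bits, every `r ≥ 2`.** [this work] -/
theorem fmb_isolation_ge (r : ℕ) (hr : 2 ≤ r) (f g : (Fin ((3 * r + 2) + (3 * r + 2)) → Bool) → Bool) (hf : IsDegLeFun 3 f)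
    (hg : IsDegLeFun 3 g) (hΦ : 1 - (1 / 2 : ℝ) ^ (2 * r + 2) ≤ forrelation f g) : forrelation f g = 1 := by
  obtain ⟨u, hu⟩ := tw_base g hg (2 * r + 2) (by omega)
  by_cases hodd : ∃ x, Odd (u x)
  · by_cases heven : ∃ x, ¬ Odd (u x)
    · exact (fmb_split_false r hr f g hf hg u hu hodd heven hΦ).elim
    · -- type O: every point costs at least `1`, total `≥ N > N/2`
      exfalso
      push Not at heven
      have hbud := fms_budget r f g u hu
      have hpow : (2 : ℝ) ^ (8 * r + 5) * (1 / 2) ^ (2 * r + 2) = 2 ^ (6 * r + 3) := by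
        rw [one_div_pow]; field_simp; ring
      have hTle : ((∑ x, (u x - 2 ^ r * sZ (f x)) ^ 2 : ℤ) : ℝ) ≤ (2 : ℝ) ^ (6 * r + 3) := by
        rw [hbud, ← hpow]
        exact mul_le_mul_of_nonneg_left (by linarith) (by positivity)
      obtain ⟨k, rfl⟩ : ∃ k, r = k + 2 := ⟨r - 2, by omega⟩
      have hge1 : ∀ x, (1 : ℤ) ≤ (u x - 2 ^ (k + 2) * sZ (f x)) ^ 2 := by
        intro x
        have hodd' : Odd (u x - 2 ^ (k + 2) * sZ (f x)) := by
          have h2 : Even ((2 : ℤ) ^ (k + 2) * sZ (f x)) := by rw [pow_succ]; exact ⟨2 ^ (k + 1) * sZ (f x), by ring⟩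
          exact Int.odd_sub.2 (iff_of_true (heven x) h2)
        have h0 := Int.odd_iff.1 hodd'
        have : u x - 2 ^ (k + 2) * sZ (f x) ≤ -1 ∨ 1 ≤ u x - 2 ^ (k + 2) * sZ (f x) := by omega
        have := tp_sq_ge (k := 1) (by norm_num) this
        linarith
      have hsum : (2 : ℤ) ^ (6 * k + 16) ≤ ∑ x, (u x - 2 ^ (k + 2) * sZ (f x)) ^ 2 := by
        have h := sum_le_sum fun x (_ : x ∈ (univ : Finset (Fin ((3 * (k + 2) + 2) + (3 * (k + 2) + 2)) → Bool))) => hge1 x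
        rw [sum_const, card_univ, Fintype.card_fun, Fintype.card_bool, Fintype.card_fin, nsmul_eq_mul, mul_one] at h
        push_cast at h
        rw [show (2 : ℤ) ^ ((3 * (k + 2) + 2) + (3 * (k + 2) + 2)) = 2 ^ (6 * k + 16) by ring] at h
        exact h
      have hsumR : (2 : ℝ) ^ (6 * k + 16) ≤ ((∑ x, (u x - 2 ^ (k + 2) * sZ (f x)) ^ 2 : ℤ) : ℝ) := by exact_mod_cast hsum
      have e : (2 : ℝ) ^ (6 * (k + 2) + 3) = 2 ^ (6 * k + 15) := by ring
      rw [e] at hTle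
      have : (2 : ℝ) ^ (6 * k + 16) = 2 * 2 ^ (6 * k + 15) := by ring
      have hpos : (0 : ℝ) < 2 ^ (6 * k + 15) := by positivity
      linarith
  · push Not at hodd
    have hu' := tw_level_up g u hu hodd
    exact fms_high_levels r hr f g hf hg _ hu' hΦ

/-- **For every `n ≡ 4 (mod 6)`, `n ≥ 16`, and all cubic `f, g : 𝔽₂ⁿ → 𝔽₂: `Φ(f,g) ≥ 1 − 2^{−(⌊n/3⌋+1)} ⇒ Φ(f,g) = 1`** (at the literal
type `Fin n`).  Infinitely many finite-slice verdicts; NOT summit progress. [this work] -/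
theorem isolation_rate_closed_four_mod_six : ∀ n : ℕ, n % 6 = 4 → 16 ≤ n → ∀ f g : (Fin n → Bool) → Bool,
    IsDegLeFun 3 f → IsDegLeFun 3 g → 1 - (1 / 2 : ℝ) ^ (n / 3 + 1) ≤ forrelation f g → forrelation f g = 1 := by
  intro n hn h16 f g hf hg hΦ
  obtain ⟨r, hr⟩ : ∃ r, n = (3 * r + 2) + (3 * r + 2) := ⟨n / 6, by omega⟩
  subst hr
  have e : ((3 * r + 2) + (3 * r + 2)) / 3 + 1 = 2 * r + 2 := by omega
  rw [e] at hΦ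
  exact fmb_isolation_ge r (by omega) f g hf hg hΦ

/-- **`θ_n < 1 − 2^{−(⌊n/3⌋+1)}` for every `n ≡ 4 (mod 6)`, `n ≥ 16`.** NOT summit progress. [this work] -/
theorem theta_lt_rate_four_mod_six (n : ℕ) (hn : n % 6 = 4) (h16 : 16 ≤ n) :
    ∃ θ : ℝ, θ < 1 - (1 / 2 : ℝ) ^ (n / 3 + 1) ∧ ∀ f g : (Fin n → Bool) → Bool, IsDegLeFun 3 f → IsDegLeFun 3 g →
      θ < forrelation f g → forrelation f g = 1 :=
  fb_theta_lt_of_closed (n := n) _ (isolation_rate_closed_four_mod_six n hn h16)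

end Summit.QuantumAdvantage.QuantumAdvantage.Theorems.CubicForrelation.NearExactIsExact

end
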